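import Summits.HodgeConjecture.HodgeConjecture.Theorems.F0P3bLocalAPacketsDefs
import HarnessLib

/-!
# FLOOR-0 P3b «ENGINE local packets», line `F0_LocalAPackets` — the `𝔲(2,1) ⊂ 𝔤𝔩(3, ℂ)` RESTRICTION LEAF and the generic
# W3 transport «sign-skew Hermitian form for the matrix units ⇒ invariant Hermitian form for `𝔲(2,1)`» (brick (w3g))

Cell hodgecm-mathlib (D-0151), FLOOR 0, crux item H413 = stmt-HodgeConjecture-24833; sub-line `Cruxes/H413/Lines/F0_LocalAPackets.lean`
(F0P3b-plan (g5), ed. 3 → ed. 4 §1K).  Brick (w3g) of F0P3b-plan (g5) 2026-08-31T02:53:55Z: ONE DEF-lane leaf hosting the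
Kovačević-INDEPENDENT half of the ed. 4 §1K block (bytes seeded in the planner's probe `F0/P3b/PROBE-ed4-u21ToGl3.F0P3b-plan-g5.lean`,
copied here VERBATIM: `u21ToGl3`, `rhoReal`, `kovLie`, `kovLie_apply`) + the generic W3 transport theorem.  Author B-p08 (g17).
DEF lane (three `def`s with bodies + theorems; no `sorry`, no instance declaration, no notation, no named fact); imports ★
`Theorems.F0P3bLocalAPacketsDefs` (+ HarnessLib) only — not on the R2 reverse cone; NEVER the Lines module.

Content.  `G21 = U(2,1) = uFormGroup (Fin 2) (Fin 1)` with Lie algebra `𝔲(2,1) = {X : Xᴴ D + D X = 0}`, `D = diag(1, 1 | −1)`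
(★ `mem_uFormGroup_lie_iff`, ★ `signForm_eq_diagonal`).  §1: the real Lie algebra map `u21ToGl3 : 𝔲(2,1) → 𝔤𝔩(3, ℂ)` (inclusion +
reindexing `Fin 2 ⊕ Fin 1 ≃ Fin 3`, the `β`-block LAST, so `D ↦ diag(s)`, `s = (1, 1, −1)` = Kovačević's `suSign`), the restriction of
scalars `rhoReal ρ` of a `𝔤𝔩(3, ℂ)`-action `ρ`, and the honest `𝔲(2,1)`-action `kovLie ρ := rhoReal ρ ∘ u21ToGl3`.  §2 (pure `Fin 3`
algebra): the entries of `M = u21ToGl3 X` satisfy `conj (M j i) = −s i s j · M i j`; hence (§3) a positive-definite Hermitian `B` with the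
SIGN-SKEWNESS `B(ρ(E_{ij}) v, w) = s i s j · B(v, ρ(E_{ji}) w)` on the matrix units (Kovačević's `IsUnitarizable`, [Kovacevic2021, §4 Thm 4])
is `kovLie ρ`-invariant: expanding `ρ M = Σ M i j • ρ(E_{ij})`, `B(ρ M v, w) = Σ conj(M i j) s i s j B(v, ρ(E_{ji}) w) = −Σ M j i B(v, ρ(E_{ji}) w)
= −B(v, ρ M w)`, i.e. `HasInvariantHermitianForm (kovLie ρ)` (★ defs leaf) — W3 of the line becomes a 5-line fold on Kovačević's
★-but-unbuilt `ladderPlus_isUnitarizable` once the farm builds that topic.  [BorelWallach2000, VI Thm 4.12] is the dictionary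
«unitary ⇒ skew-Hermitian `𝔤`-action».

HC_CM is proved only modulo the 7 printed citations until rung 0 closes; this is ONE helper leaf of ONE floor-0 sub-line.

## References
* [Kovacevic2021] D. Kovačević, *the `(𝔤, K)`-modules of `SU(2,1)` from `K`-types* (2021) — §2 (the signs `ε = (1,1,−1)`), §4 Thm 4
  (unitarizability: `B(E_{ij} v, w) = ε_i ε_j B(v, E_{ji} w)`).
* [BorelWallach2000] A. Borel, N. Wallach, *Continuous Cohomology, Discrete Subgroups, and Representations of Reductive Groups*, 2nd ed.,
  AMS 2000 — VI Thm 4.12.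
-/

set_option autoImplicit false
set_option linter.dupNamespace false

noncomputable section

open scoped ComplexConjugate

namespace Summit.HodgeConjecture.HodgeConjecture.Cruxes.H413.F0P3bU21Restriction

open Literature.NumberTheory.Automorphic
open Literature.RepresentationTheory.BorelWallach2000
open Literature.RepresentationTheory.KonnoKonno2007 Literature.RepresentationTheory.KonnoKonno2007.RealDualPair
open Literature.RepresentationTheory.KonnoKonno2007.RealDualPair.UForm
open Summit.HodgeConjecture.HodgeConjecture.Cruxes.H413.F0P3bLocalAPacketsDefs

-- Mathlib idiom (as in `GKModules`, the `Upq*` files, the defs leaf and the line): commutator bracket on `Module.End` ∕ matrices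
attribute [local instance 100] LieRing.ofAssociativeRing

/-! ## §1 The restriction `𝔲(2,1) ⊂ 𝔤𝔩(3, ℂ)` and the honest `𝔲(2,1)`-action of a `𝔤𝔩(3, ℂ)`-module (VERBATIM from the probe) -/

/-- **`𝔲(2,1) ⊂ 𝔤𝔩(3, ℂ)` reindexed along `Fin 2 ⊕ Fin 1 ≃ Fin 3`** (the `β`-block last): a morphism of REAL Lie algebras.
[cite: Kovacevic2021, §2] -/
noncomputable def u21ToGl3 : G21.lie →ₗ⁅ℝ⁆ Matrix (Fin 3) (Fin 3) ℂ :=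
  ((Matrix.reindexAlgEquiv ℝ ℂ (finSumFinEquiv : Fin 2 ⊕ Fin 1 ≃ Fin 3)).toAlgHom.toLieHom).comp
    (uFormGroup (Fin 2) (Fin 1)).lie.incl

variable {V : Type} [AddCommGroup V] [Module ℂ V]

/-- **A `𝔤𝔩(3, ℂ)`-action with scalars restricted to `ℝ`.** [cite: Kovacevic2021, §3] -/
noncomputable def rhoReal (ρ : Matrix (Fin 3) (Fin 3) ℂ →ₗ⁅ℂ⁆ Module.End ℂ V) : Matrix (Fin 3) (Fin 3) ℂ →ₗ⁅ℝ⁆ Module.End ℂ V :=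
  { (ρ : Matrix (Fin 3) (Fin 3) ℂ →ₗ⁅ℂ⁆ Module.End ℂ V).toLinearMap.restrictScalars ℝ with
    map_lie' := fun {x y} => by simp }

/-- **The honest `𝔲(2,1)`-action** `kovLie ρ = ρ ∘ (𝔲(2,1) ⊂ 𝔤𝔩(3, ℂ))` of a `𝔤𝔩(3, ℂ)`-module. [cite: Kovacevic2021, §3] -/
noncomputable def kovLie (ρ : Matrix (Fin 3) (Fin 3) ℂ →ₗ⁅ℂ⁆ Module.End ℂ V) : G21.lie →ₗ⁅ℝ⁆ Module.End ℂ V :=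
  (rhoReal ρ).comp u21ToGl3

/-- `kovLie ρ X = ρ (reindex X)` (definitional). [cite: Kovacevic2021, §3] -/
theorem kovLie_apply (ρ : Matrix (Fin 3) (Fin 3) ℂ →ₗ⁅ℂ⁆ Module.End ℂ V) (X : G21.lie) :
    kovLie ρ X = ρ (Matrix.reindex (finSumFinEquiv : Fin 2 ⊕ Fin 1 ≃ Fin 3) (finSumFinEquiv : Fin 2 ⊕ Fin 1 ≃ Fin 3) (X : Matrix (Fin 2 ⊕ Fin 1) (Fin 2 ⊕ Fin 1) ℂ)) :=
  rfl

/-! ## §2 The entries of `𝔲(2,1)` inside `𝔤𝔩(3, ℂ)`: `conj (M j i) = − s i · s j · M i j`, `s = (1, 1, −1)` -/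

/-- The reindexing `Fin 2 ⊕ Fin 1 ≃ Fin 3` sends the diagonal form `diag(1_α, −1_β)` to the signs `s = (1, 1, −1)` (Kovačević's `ε`):
`D(e⁻¹ i) = s i`. [cite: Kovacevic2021, §2] -/
theorem signForm_entry_finSumFinEquiv_symm (i : Fin 3) :
    Sum.elim (fun _ : Fin 2 => (1 : ℂ)) (fun _ : Fin 1 => -1) ((finSumFinEquiv : Fin 2 ⊕ Fin 1 ≃ Fin 3).symm i) =
      (if i = 2 then -1 else 1 : ℂ) := by
  have h0 : (finSumFinEquiv : Fin 2 ⊕ Fin 1 ≃ Fin 3).symm 0 = Sum.inl 0 := by decide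
  have h1 : (finSumFinEquiv : Fin 2 ⊕ Fin 1 ≃ Fin 3).symm 1 = Sum.inl 1 := by decide
  have h2 : (finSumFinEquiv : Fin 2 ⊕ Fin 1 ≃ Fin 3).symm 2 = Sum.inr 0 := by decide
  fin_cases i
  · simp [h0]
  · simp [h1]
  · simp [h2]

/-- **The entries of `𝔲(2,1) ⊂ 𝔤𝔩(3, ℂ)`**: for `X ∈ 𝔲(2,1)` (`Xᴴ D + D X = 0`, `D = diag(1, 1 | −1)`) the reindexed matrix
`M = u21ToGl3 X` satisfies `conj (M j i) = −(s i · s j) · M i j` with `s = (1, 1, −1)`. [cite: Kovacevic2021, §2] -/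
theorem star_reindex_apply (X : G21.lie) (i j : Fin 3) :
    conj ((Matrix.reindex (finSumFinEquiv : Fin 2 ⊕ Fin 1 ≃ Fin 3) (finSumFinEquiv : Fin 2 ⊕ Fin 1 ≃ Fin 3) (X : Matrix (Fin 2 ⊕ Fin 1) (Fin 2 ⊕ Fin 1) ℂ)) j i) =
      -((if i = 2 then -1 else 1 : ℂ) * (if j = 2 then -1 else 1 : ℂ)) *
        (Matrix.reindex (finSumFinEquiv : Fin 2 ⊕ Fin 1 ≃ Fin 3) (finSumFinEquiv : Fin 2 ⊕ Fin 1 ≃ Fin 3) (X : Matrix (Fin 2 ⊕ Fin 1) (Fin 2 ⊕ Fin 1) ℂ)) i j := by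
  set a := (finSumFinEquiv : Fin 2 ⊕ Fin 1 ≃ Fin 3).symm i with ha
  set b := (finSumFinEquiv : Fin 2 ⊕ Fin 1 ≃ Fin 3).symm j with hb
  have hX := (mem_uFormGroup_lie_iff (X : Matrix (Fin 2 ⊕ Fin 1) (Fin 2 ⊕ Fin 1) ℂ)).1 X.2
  rw [signForm_eq_diagonal] at hX
  -- entry `(a, b)` of `Xᴴ D + D X = 0`: `conj (X b a) * d b + d a * X a b = 0`
  have hab := congrFun (congrFun hX a) b
  rw [Matrix.add_apply, Matrix.mul_diagonal, Matrix.diagonal_mul, Matrix.conjTranspose_apply, Matrix.zero_apply] at hab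
  have hda : Sum.elim (fun _ : Fin 2 => (1 : ℂ)) (fun _ : Fin 1 => -1) a = (if i = 2 then -1 else 1 : ℂ) :=
    signForm_entry_finSumFinEquiv_symm i
  have hdb : Sum.elim (fun _ : Fin 2 => (1 : ℂ)) (fun _ : Fin 1 => -1) b = (if j = 2 then -1 else 1 : ℂ) :=
    signForm_entry_finSumFinEquiv_symm j
  rw [hda, hdb] at hab
  simp only [Matrix.reindex_apply, Matrix.submatrix_apply]
  rw [← ha, ← hb]
  -- `conj (X b a) * s j + s i * X a b = 0` ⇒ `conj (X b a) = −(s i s j) X a b` (`s j² = 1`)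
  have hsj : (if j = 2 then -1 else 1 : ℂ) * (if j = 2 then -1 else 1 : ℂ) = 1 := by split_ifs <;> norm_num
  have h := congrArg (fun z => z * (if j = 2 then -1 else 1 : ℂ)) hab
  simp only [add_mul, zero_mul, mul_assoc, hsj, mul_one] at h
  rw [RCLike.star_def] at h
  linear_combination h

/-! ## §3 Generic W3 transport: sign-skewness on the matrix units ⇒ an invariant Hermitian form for `𝔲(2,1)` -/

/-- `ρ M = Σ_{(i,j)} M i j • ρ(E_{ij})` for a `ℂ`-linear `𝔤𝔩(3, ℂ)`-action (expansion along the matrix units `E_{ij} = Matrix.single i j 1`,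
as ONE sum over the index pairs). [cite: Kovacevic2021, §3] -/
theorem rho_eq_sum_single (ρ : Matrix (Fin 3) (Fin 3) ℂ →ₗ⁅ℂ⁆ Module.End ℂ V) (M : Matrix (Fin 3) (Fin 3) ℂ) :
    ρ M = ∑ p : Fin 3 × Fin 3, M p.1 p.2 • ρ (Matrix.single p.1 p.2 1) := by
  rw [Fintype.sum_prod_type]
  dsimp only
  conv_lhs => rw [Matrix.matrix_eq_sum_single M]
  rw [map_sum]
  refine Finset.sum_congr rfl fun i _ => ?_
  rw [map_sum]
  refine Finset.sum_congr rfl fun j _ => ?_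
  rw [show Matrix.single i j (M i j) = M i j • Matrix.single i j (1 : ℂ) by
    rw [Matrix.smul_single, smul_eq_mul, mul_one], map_smul]

/-- **W3 TRANSPORT (generic).**  Let `ρ` be a `𝔤𝔩(3, ℂ)`-module on `V` and `B` a positive-definite Hermitian form (conjugate-linear in
the first variable) which is SIGN-SKEW on the matrix units, `B(ρ(E_{ij}) v, w) = s i · s j · B(v, ρ(E_{ji}) w)` with `s = (1, 1, −1)`
(Kovačević's `IsUnitarizable`: «`𝔰𝔲(2,1)` acts by skew-adjoint operators»).  Then `B` is an invariant Hermitian form for the honest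
`𝔲(2,1)`-action `kovLie ρ`: `B(ρ(X) v, w) = −B(v, ρ(X) w)` for every `X ∈ 𝔲(2,1)` — i.e. `HasInvariantHermitianForm (kovLie ρ)` of
the defs leaf (W3 of the line `F0_LocalAPackets`, for `ρ = ladderPlus.ρ`). [cite: Kovacevic2021, §4 Thm 4; BorelWallach2000, VI Thm 4.12] -/
theorem hasInvariantHermitianForm_kovLie_of_signSkew (ρ : Matrix (Fin 3) (Fin 3) ℂ →ₗ⁅ℂ⁆ Module.End ℂ V)
    (B : V →ₗ⋆[ℂ] V →ₗ[ℂ] ℂ) (hB : ∀ v w, B v w = starRingEnd ℂ (B w v)) (hpos : ∀ v, v ≠ 0 → 0 < (B v v).re)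
    (hE : ∀ (i j : Fin 3) (v w : V), B (ρ (Matrix.single i j 1) v) w =
      (if i = 2 then -1 else 1 : ℂ) * (if j = 2 then -1 else 1 : ℂ) * B v (ρ (Matrix.single j i 1) w)) :
    HasInvariantHermitianForm (kovLie ρ) := by
  refine ⟨B, hB, hpos, fun X v w => ?_⟩
  have hsq : ∀ k : Fin 3, (if k = 2 then -1 else 1 : ℂ) * (if k = 2 then -1 else 1 : ℂ) = 1 := fun k => by
    split_ifs <;> norm_num
  -- the sign relation on the entries of `M = u21ToGl3 X`, in the form `conj (M i j) · (s i s j) = − M j i`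
  have hent : ∀ i j : Fin 3,
      conj ((Matrix.reindex (finSumFinEquiv : Fin 2 ⊕ Fin 1 ≃ Fin 3) (finSumFinEquiv : Fin 2 ⊕ Fin 1 ≃ Fin 3) (X : Matrix (Fin 2 ⊕ Fin 1) (Fin 2 ⊕ Fin 1) ℂ)) i j) *
          ((if i = 2 then -1 else 1 : ℂ) * (if j = 2 then -1 else 1 : ℂ)) =
        -(Matrix.reindex (finSumFinEquiv : Fin 2 ⊕ Fin 1 ≃ Fin 3) (finSumFinEquiv : Fin 2 ⊕ Fin 1 ≃ Fin 3) (X : Matrix (Fin 2 ⊕ Fin 1) (Fin 2 ⊕ Fin 1) ℂ)) j i := by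
    intro i j
    rw [star_reindex_apply X j i]
    linear_combination
      (-((Matrix.reindex (finSumFinEquiv : Fin 2 ⊕ Fin 1 ≃ Fin 3) (finSumFinEquiv : Fin 2 ⊕ Fin 1 ≃ Fin 3) (X : Matrix (Fin 2 ⊕ Fin 1) (Fin 2 ⊕ Fin 1) ℂ)) j i) *
          ((if j = 2 then -1 else 1 : ℂ) * (if j = 2 then -1 else 1 : ℂ))) * hsq i -
        (Matrix.reindex (finSumFinEquiv : Fin 2 ⊕ Fin 1 ≃ Fin 3) (finSumFinEquiv : Fin 2 ⊕ Fin 1 ≃ Fin 3) (X : Matrix (Fin 2 ⊕ Fin 1) (Fin 2 ⊕ Fin 1) ℂ)) j i * hsq j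
  rw [kovLie_apply]
  generalize (Matrix.reindex (finSumFinEquiv : Fin 2 ⊕ Fin 1 ≃ Fin 3) (finSumFinEquiv : Fin 2 ⊕ Fin 1 ≃ Fin 3) (X : Matrix (Fin 2 ⊕ Fin 1) (Fin 2 ⊕ Fin 1) ℂ)) = M at hent ⊢
  -- linearity bookkeeping for `T ↦ B (T v) w` (conjugate-linear) and `T ↦ B v (T w)` (linear)
  have hsumL : ∀ T : Fin 3 × Fin 3 → Module.End ℂ V, B ((∑ p, T p) v) w = ∑ p, B (T p v) w := fun T => by
    rw [LinearMap.sum_apply, map_sum, LinearMap.sum_apply]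
  have hsumR : ∀ T : Fin 3 × Fin 3 → Module.End ℂ V, B v ((∑ p, T p) w) = ∑ p, B v (T p w) := fun T => by
    rw [LinearMap.sum_apply, map_sum]
  have hsmulL : ∀ (c : ℂ) (T : Module.End ℂ V), B ((c • T) v) w = conj c * B (T v) w := fun c T => by
    rw [LinearMap.smul_apply, LinearMap.map_smulₛₗ, LinearMap.smul_apply, smul_eq_mul]
  have hsmulR : ∀ (c : ℂ) (T : Module.End ℂ V), B v ((c • T) w) = c * B v (T w) := fun c T => by
    rw [LinearMap.smul_apply, map_smul, smul_eq_mul]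
  -- expand both sides along the matrix units; on the right, re-index the pairs by the swap `(i, j) ↦ (j, i)`
  rw [rho_eq_sum_single ρ M, hsumL, hsumR, ← Finset.sum_neg_distrib,
    show (∑ p : Fin 3 × Fin 3, -(B v ((M p.1 p.2 • ρ (Matrix.single p.1 p.2 1)) w))) =
        ∑ p : Fin 3 × Fin 3, -(B v ((M p.2 p.1 • ρ (Matrix.single p.2 p.1 1)) w)) from
      (Equiv.sum_comp (Equiv.prodComm (Fin 3) (Fin 3)) _).symm]
  refine Finset.sum_congr rfl fun p _ => ?_
  rw [hsmulL, hsmulR, hE, ← mul_assoc, hent p.1 p.2, neg_mul]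

end Summit.HodgeConjecture.HodgeConjecture.Cruxes.H413.F0P3bU21Restriction
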